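import Mathlib
import Summits.Ventures.HodgeRepro.Tier4.Common.AdelicDefs
import Summits.Ventures.HodgeRepro.Tier4.Line1.NormOneTorusAlgebra

/-!
# Tier4/Line1/TorusBlock — the torus block `diag(1, 1, ρ(c))` and its conjugates (algebra for the `hstab` bridge)

Blind re-derivation cell `pub-hodge-repro`, Tier 4 «PROVE THE STEP» (README §9–§10), LINE L1, seat t4-L1-p3 (prover);
the pure-algebra half of the bridge (i)+(ii) ⇒ `hstab` (S12962; lead g385 R-II, p5 S12955, p2 S12952). Over any
commutative ring `R`: `torusBlock d c = diag(1, 1, [[c₀, c₁], [−d c₁, c₀]])` is the action of the torus element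
`c₀ + c₁ Ω` (`Ω² = −d`) on an adapted basis `(v, vΩ, w, wΩ)` (row convention), `Jd d = diag(J_d, J_d)` the action of
`Ω` itself; `torusBlock` is multiplicative for `qmul d` (t4-L1-p5's `NormOneTorusAlgebra`), commutes with `Jd d` and
preserves the adapted Gram matrix `diag(a, d a, a′, d a′)` when `c₀² + d c₁² = 1`. `conjBlock S S' d c = S' ·
torusBlock d c · S` (`S` the adapted rows, `S'` its inverse) then commutes with `Om` whenever `S Om = Jd S` and is a
`B`-isometry whenever `S B Sᵀ` is the adapted Gram matrix — the torus of `U(W)` fixing the `v`-line. Row lemmas for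
`Jd · A` and `torusBlock · A` close the section. Mathlib + NormOneTorusAlgebra only; no printed input.

Nothing here says anything about the status of the Hodge conjecture for CM abelian varieties, which is NOT proved
(HC_CM is NOT proved by anyone in this repository).
-/

set_option autoImplicit false

noncomputable section

namespace Summit.Ventures.HodgeRepro.Tier4.Line1.Rot

open Matrix

variable {R : Type*} [CommRing R]

/-- The block matrix `diag(1, 1, ρ(c))`, `ρ(c) = [[c₀, c₁], [−d c₁, c₀]]`: the action of the torus element
`c₀ + c₁ Ω` on an adapted basis `(v, vΩ, w, wΩ)` (row convention, acting on the `w`-line only). -/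
def torusBlock (d : R) (c : Fin 2 → R) : Matrix (Fin 4) (Fin 4) R :=
  !![1, 0, 0, 0; 0, 1, 0, 0; 0, 0, c 0, c 1; 0, 0, -(d * c 1), c 0]

/-- The matrix of `Ω` on an adapted basis (rows `v, vΩ, w, wΩ`): `diag(J_d, J_d)`, `J_d = [[0, 1], [−d, 0]]`. -/
def Jd (d : R) : Matrix (Fin 4) (Fin 4) R := !![0, 1, 0, 0; -d, 0, 0, 0; 0, 0, 0, 1; 0, 0, -d, 0]

/-- `torusBlock` is multiplicative for the torus multiplication `qmul`. -/
theorem torusBlock_mul (d : R) (c c' : Fin 2 → R) :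
    torusBlock d c * torusBlock d c' = torusBlock d (qmul d c c') := by
  ext i j
  fin_cases i <;> fin_cases j <;>
    simp [torusBlock, qmul, Matrix.mul_apply, Fin.sum_univ_four] <;> ring

/-- `torusBlock d 1 = 1`. -/
theorem torusBlock_qone (d : R) : torusBlock d qone = 1 := by
  ext i j
  fin_cases i <;> fin_cases j <;> simp [torusBlock, qone]

/-- `torusBlock d c` commutes with `diag(J_d, J_d)`. -/
theorem torusBlock_comm_Jd (d : R) (c : Fin 2 → R) : torusBlock d c * Jd d = Jd d * torusBlock d c := by
  ext i j
  fin_cases i <;> fin_cases j <;>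
    simp [torusBlock, Jd, Matrix.mul_apply, Fin.sum_univ_four] <;> ring

/-- `torusBlock d c` is an isometry of the adapted Gram matrix `diag(a, d a, a′, d a′)` when `c₀² + d c₁² = 1`. -/
theorem torusBlock_gram (d : R) {c : Fin 2 → R} (hc : qnorm d c = 1) (a a' : R) :
    torusBlock d c * Matrix.diagonal ![a, d * a, a', d * a'] * (torusBlock d c)ᵀ =
      Matrix.diagonal ![a, d * a, a', d * a'] := by
  simp only [qnorm] at hc
  ext i j
  fin_cases i <;> fin_cases j <;>
    simp [torusBlock, Matrix.mul_apply, Matrix.transpose_apply, Matrix.vecMul_diagonal, Fin.sum_univ_four] <;>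
    first
    | linear_combination a' * hc
    | linear_combination (d * a') * hc
    | ring

section Conj

variable (S S' : Matrix (Fin 4) (Fin 4) R) (d : R)

/-- The conjugate `S⁻¹ · torusBlock d c · S` of the torus block by an adapted basis `S` (rows `v, vΩ, w, wΩ`),
`S'` its inverse: the element of `U(W)` fixing the `v`-line and acting on the `w`-line by `c₀ + c₁ Ω`. -/
def conjBlock (c : Fin 2 → R) : Matrix (Fin 4) (Fin 4) R := S' * torusBlock d c * S

variable {S S'}

/-- `conjBlock` is multiplicative. -/
theorem conjBlock_mul (hSS' : S * S' = 1) (c c' : Fin 2 → R) :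
    conjBlock S S' d c * conjBlock S S' d c' = conjBlock S S' d (qmul d c c') := by
  simp only [conjBlock]
  rw [← torusBlock_mul]
  calc S' * torusBlock d c * S * (S' * torusBlock d c' * S)
      = S' * torusBlock d c * (S * S') * torusBlock d c' * S := by simp only [Matrix.mul_assoc]
    _ = S' * (torusBlock d c * torusBlock d c') * S := by
        rw [hSS', Matrix.mul_one]; simp only [Matrix.mul_assoc]

/-- `conjBlock` of `1`. -/
theorem conjBlock_qone (hS'S : S' * S = 1) : conjBlock S S' d qone = 1 := by
  rw [conjBlock, torusBlock_qone, Matrix.mul_one, hS'S]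

/-- `S · conjBlock c = torusBlock c · S`: the rows of `S` are moved by the block. -/
theorem mul_conjBlock (hSS' : S * S' = 1) (c : Fin 2 → R) :
    S * conjBlock S S' d c = torusBlock d c * S := by
  rw [conjBlock, ← Matrix.mul_assoc, ← Matrix.mul_assoc, hSS', Matrix.one_mul]

/-- `conjBlock c` commutes with `Om` when `S · Om = Jd · S` (`Om` acts on the adapted basis by `diag(J_d, J_d)`). -/
theorem conjBlock_comm (hSS' : S * S' = 1) (hS'S : S' * S = 1) {Om : Matrix (Fin 4) (Fin 4) R}
    (hSOm : S * Om = Jd d * S) (c : Fin 2 → R) :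
    conjBlock S S' d c * Om = Om * conjBlock S S' d c := by
  have hOm : Om = S' * Jd d * S := by
    calc Om = (S' * S) * Om := by rw [hS'S, Matrix.one_mul]
      _ = S' * (S * Om) := by rw [Matrix.mul_assoc]
      _ = S' * Jd d * S := by rw [hSOm, Matrix.mul_assoc]
  rw [hOm, conjBlock]
  calc S' * torusBlock d c * S * (S' * Jd d * S)
      = S' * (torusBlock d c * (S * S') * Jd d) * S := by simp only [Matrix.mul_assoc]
    _ = S' * (torusBlock d c * Jd d) * S := by rw [hSS', Matrix.mul_one]
    _ = S' * (Jd d * torusBlock d c) * S := by rw [torusBlock_comm_Jd]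
    _ = S' * (Jd d * (S * S') * torusBlock d c) * S := by rw [hSS', Matrix.mul_one]
    _ = S' * Jd d * S * (S' * torusBlock d c * S) := by simp only [Matrix.mul_assoc]

/-- `conjBlock c` is a `B`-isometry (row convention `g B gᵀ = B`) when `S B Sᵀ` is the adapted Gram matrix and
`c₀² + d c₁² = 1`. -/
theorem conjBlock_isometry (hSS' : S * S' = 1) (hS'S : S' * S = 1) {B : Matrix (Fin 4) (Fin 4) R} {a a' : R}
    (hG : S * B * Sᵀ = Matrix.diagonal ![a, d * a, a', d * a']) {c : Fin 2 → R} (hc : qnorm d c = 1) :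
    conjBlock S S' d c * B * (conjBlock S S' d c)ᵀ = B := by
  have h1 : S'ᵀ * Sᵀ = 1 := by rw [← Matrix.transpose_mul, hSS', Matrix.transpose_one]
  have hB : B = S' * Matrix.diagonal ![a, d * a, a', d * a'] * S'ᵀ := by
    rw [← hG]
    calc B = (S' * S) * B * (S' * S)ᵀ := by rw [hS'S, Matrix.one_mul, Matrix.transpose_one, Matrix.mul_one]
      _ = S' * (S * B * Sᵀ) * S'ᵀ := by rw [Matrix.transpose_mul]; simp only [Matrix.mul_assoc]
  rw [hB, conjBlock, Matrix.transpose_mul, Matrix.transpose_mul]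
  calc S' * torusBlock d c * S * (S' * Matrix.diagonal ![a, d * a, a', d * a'] * S'ᵀ) *
        (Sᵀ * ((torusBlock d c)ᵀ * S'ᵀ))
      = S' * torusBlock d c * (S * S') * Matrix.diagonal ![a, d * a, a', d * a'] * (S'ᵀ * Sᵀ) *
          (torusBlock d c)ᵀ * S'ᵀ := by simp only [Matrix.mul_assoc]
    _ = S' * (torusBlock d c * Matrix.diagonal ![a, d * a, a', d * a'] * (torusBlock d c)ᵀ) * S'ᵀ := by
        rw [hSS', h1, Matrix.mul_one, Matrix.mul_one]; simp only [Matrix.mul_assoc]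
    _ = S' * Matrix.diagonal ![a, d * a, a', d * a'] * S'ᵀ := by rw [torusBlock_gram d hc a a']

end Conj

section Rows

variable (d : R) (c : Fin 2 → R) (A : Matrix (Fin 4) (Fin 4) R)

/-- Row `i` of a product is the `vecMul` of row `i`. -/
theorem mul_row (B : Matrix (Fin 4) (Fin 4) R) (i : Fin 4) : (A * B) i = A i ᵥ* B := rfl

/-- Row `0` of `Jd · A` is row `1` of `A`. -/
theorem Jd_mul_row_zero : (Jd d * A) 0 = A 1 := by
  ext j; simp [Jd, Matrix.mul_apply, Fin.sum_univ_four]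

/-- Row `1` of `Jd · A` is `−d ·` row `0` of `A`. -/
theorem Jd_mul_row_one : (Jd d * A) 1 = -(d • A 0) := by
  ext j; simp [Jd, Matrix.mul_apply, Fin.sum_univ_four]

/-- Row `2` of `Jd · A` is row `3` of `A`. -/
theorem Jd_mul_row_two : (Jd d * A) 2 = A 3 := by
  ext j; simp [Jd, Matrix.mul_apply, Fin.sum_univ_four]

/-- Row `3` of `Jd · A` is `−d ·` row `2` of `A`. -/
theorem Jd_mul_row_three : (Jd d * A) 3 = -(d • A 2) := by
  ext j; simp [Jd, Matrix.mul_apply, Fin.sum_univ_four]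

/-- Row `0` of `torusBlock · A` is row `0` of `A` (the `v`-line is fixed). -/
theorem torusBlock_mul_row_zero : (torusBlock d c * A) 0 = A 0 := by
  ext j; simp [torusBlock, Matrix.mul_apply, Fin.sum_univ_four]

/-- Row `1` of `torusBlock · A` is row `1` of `A`. -/
theorem torusBlock_mul_row_one : (torusBlock d c * A) 1 = A 1 := by
  ext j; simp [torusBlock, Matrix.mul_apply, Fin.sum_univ_four]

/-- Row `2` of `torusBlock · A` is `c₀ ·` row `2` `+ c₁ ·` row `3`. -/
theorem torusBlock_mul_row_two : (torusBlock d c * A) 2 = c 0 • A 2 + c 1 • A 3 := by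
  ext j; simp [torusBlock, Matrix.mul_apply, Fin.sum_univ_four]

/-- Row `3` of `torusBlock · A` is `−d c₁ ·` row `2` `+ c₀ ·` row `3`. -/
theorem torusBlock_mul_row_three : (torusBlock d c * A) 3 = -(d * c 1) • A 2 + c 0 • A 3 := by
  ext j; simp [torusBlock, Matrix.mul_apply, Fin.sum_univ_four]

end Rows

end Summit.Ventures.HodgeRepro.Tier4.Line1.Rot

end
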